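import Summits.Parity.GeneralizedHardyLittlewood.Theorems.PrimeLevelFamEdgeMomentsBeyondDiagonalDiagGenericRemFamily
import HarnessLib

/-!
# Route `PrimeLevelFamEdge`, crux K_A `MomentsBeyondDiagonal` (stmt-Parity-20007), line «petersson_layers» v4, stub `stub_diag`:
# **the family bound of the WHOLE remainder weight of the GENERIC order `(i,j)`** (brick (R2b) of the generic remainder estimate
# (R_ij), census `Cruxes/MomentsBeyondDiagonal/Lines/petersson_layers_stub_diag_g19_generic_assembly.md`)

The remainder weight `rem_ij` of `…DiagGenericAssembly.selbergOrder_split i j`, in the abstract coordinates `(Y, α, β)` of the inner sums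
(`L = log(Q²/(g²k₁k₂)) = 2β + ℓ⁺(k₁) + ℓ⁺(k₂)`, decorations `S_t`, kernels `R_ab`), is the five-level finite sum
`W(k₁,k₂) = Σ_{a≤i,b≤j} C(i,a)C(j,b)·((1/2)^N Σ_{r≤i−a,s≤j−b} C(i−a,r)C(j−b,s)(−1)^s L^{N−r−s} Σ_{t≤r+s} C(r+s,t) S_t(k₁)S_{r+s−t}(k₂))·R_ab(αk₁k₂)`,
`N = i−a+(j−b)`. From the family bounds of the decorated kernels `S_t ⊗ S_{t′} · R_ab` (one envelope `Ψ` for all `a ≤ i`, `b ≤ j`,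
`t, t′ ≤ i+j` — supplied by `…DiagGenericRemFamilies.families_gen`) the generic `L^p` lemma `…DiagGenericRemFamily.fam_Lpow` and the
linear-combination lemma `…DiagGenericRemFamily.fam_finset_sum`, applied level by level, give the family bound of `W` itself with the
envelope `K(i,j)·(4Λ)^{i+j}·Ψ` (`K(i,j)` = the nested sum of the absolute coefficients; only its existence is used downstream):

* `fam_mono` — the family bound is monotone in the envelope;
* `fam_weight_gen i j` — **∃ `K ≥ 0`: for all coefficient sequences `a`, decorations `S`, kernels `R` and data `(Y, α, β, Λ, Ψ)` with the
  family bounds of `S_t ⊗ S_{t′} · R_ab`, the family bound `|Σ_{k₁,k₂≤Y} a(k₁)a(k₂)ℓ⁺(k₁)^{m₁}ℓ⁺(k₂)^{m₂}·W(k₁,k₂)| ≤ log^{m₁+m₂}Y·(K(4Λ)^{i+j}Ψ)`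
  (`m₁, m₂ ≥ 1`).**

Def-free; theorems only. Helper `--supports stmt-Parity-20007`; closes nothing; K_A, K_B and the Parity summit are NOT proved;
nothing about Landau–Siegel zeros.

## References
* E. Kowalski, P. Michel, J. VanderKam, J. reine angew. Math. 526 (2000), (23)–(28) pp. 13–15 and Prop. 5.1 p. 18.
  [cite: KowalskiMichelVanderKam2000, (23)–(28) and Prop. 5.1 — derivation (remainder weight of the diagonal, every order)]
-/

noncomputable section

open Finset Real

namespace Summit.Parity.GeneralizedHardyLittlewood.Theorems.MomentsBeyondDiagonal.DiagCorner

open Summit.Parity.GeneralizedHardyLittlewood.Theorems.BeyondDiagonalBeatsQuarter.Corner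

/-- The family bound is monotone in the envelope. [folklore] -/
theorem fam_mono {a : ℕ → ℝ} {Y Ψ₁ Ψ₂ : ℝ} {G : ℕ → ℕ → ℝ} (hLY0 : 0 ≤ Real.log Y) (hΨ : Ψ₁ ≤ Ψ₂)
    (h : ∀ m₁ m₂ : ℕ, 1 ≤ m₁ → 1 ≤ m₂ →
      |∑ k₁ ∈ Icc 1 ⌊Y⌋₊, ∑ k₂ ∈ Icc 1 ⌊Y⌋₊,
          a k₁ * a k₂ * ellp Y k₁ ^ m₁ * ellp Y k₂ ^ m₂ * (G k₁ k₂)| ≤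
        Real.log Y ^ (m₁ + m₂) * (Ψ₁)) :
    ∀ m₁ m₂ : ℕ, 1 ≤ m₁ → 1 ≤ m₂ →
      |∑ k₁ ∈ Icc 1 ⌊Y⌋₊, ∑ k₂ ∈ Icc 1 ⌊Y⌋₊,
          a k₁ * a k₂ * ellp Y k₁ ^ m₁ * ellp Y k₂ ^ m₂ * (G k₁ k₂)| ≤
        Real.log Y ^ (m₁ + m₂) * (Ψ₂) :=
  fun m₁ m₂ h₁ h₂ ↦ (h m₁ m₂ h₁ h₂).trans (mul_le_mul_of_nonneg_left hΨ (pow_nonneg hLY0 _))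

set_option maxHeartbeats 6400000 in
/-- **The family bound of the whole remainder weight of the generic order `(i,j)`** (module docstring).
[cite: KowalskiMichelVanderKam2000, (23)–(28) and Prop. 5.1 — derivation (remainder weight of the diagonal, every order)] -/
theorem fam_weight_gen (i j : ℕ) : ∃ K : ℝ, 0 ≤ K ∧
    ∀ (a : ℕ → ℝ) (S : ℕ → ℕ → ℝ) (R : ℕ → ℕ → ℝ → ℝ) (Y α β Λ Ψ : ℝ), 1 ≤ Λ → |β| ≤ Λ → 0 ≤ Real.log Y →
      Real.log Y ≤ Λ → 0 ≤ Ψ →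
      (∀ a' b' t t' : ℕ, a' ≤ i → b' ≤ j → t ≤ i + j → t' ≤ i + j → ∀ n₁ n₂ : ℕ, 1 ≤ n₁ → 1 ≤ n₂ →
      |∑ k₁ ∈ Icc 1 ⌊Y⌋₊, ∑ k₂ ∈ Icc 1 ⌊Y⌋₊,
          a k₁ * a k₂ * ellp Y k₁ ^ n₁ * ellp Y k₂ ^ n₂ * (S t k₁ * S t' k₂ * R a' b' (α * k₁ * k₂))| ≤
        Real.log Y ^ (n₁ + n₂) * (Ψ)) →
    ∀ m₁ m₂ : ℕ, 1 ≤ m₁ → 1 ≤ m₂ →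
      |∑ k₁ ∈ Icc 1 ⌊Y⌋₊, ∑ k₂ ∈ Icc 1 ⌊Y⌋₊,
          a k₁ * a k₂ * ellp Y k₁ ^ m₁ * ellp Y k₂ ^ m₂ * (∑ a ∈ range (i + 1), ∑ b ∈ range (j + 1),
                (i.choose a : ℝ) * (j.choose b) *
                ((1 / 2) ^ (i - a + (j - b)) * ∑ r ∈ range (i - a + 1), ∑ s ∈ range (j - b + 1),
                  ((i - a).choose r : ℝ) * ((j - b).choose s) * (-1) ^ s *
                      (2 * β + ellp Y k₁ + ellp Y k₂) ^ (i - a - r + (j - b - s)) *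
                    ∑ t ∈ range (r + s + 1), ((r + s).choose t : ℝ) *
                      (S t k₁ *
                        S (r + s - t) k₂)) *
                R a b (α * k₁ * k₂))| ≤
        Real.log Y ^ (m₁ + m₂) * (K * (4 * Λ) ^ (i + j) * Ψ) := by
  refine ⟨∑ a ∈ range (i + 1), |(i.choose a : ℝ)| * (∑ b ∈ range (j + 1), |(j.choose b : ℝ)| * (∑ r ∈ range (i - a + 1), |(1 / 2 : ℝ) ^ (i - a + (j - b)) * ((i - a).choose r : ℝ)| * (∑ s ∈ range (j - b + 1), |((j - b).choose s : ℝ) * (-1) ^ s| * (∑ t ∈ range (r + s + 1), |((r + s).choose t : ℝ)|)))), by positivity,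
    fun a S R Y α β Λ Ψ hΛ hβ hLY0 hLY hΨ hfam ↦ ?_⟩
  have h4Λ : (1 : ℝ) ≤ 4 * Λ := by linarith
  have hE0 : 0 ≤ (4 * Λ) ^ (i + j) * Ψ := by positivity
  -- level 5: one decorated `L^p`-monomial
  have h5 : ∀ a' : ℕ, a' ≤ i → ∀ b' : ℕ, b' ≤ j → ∀ r s t : ℕ, r ≤ i - a' → s ≤ j - b' → t ≤ r + s →
      ∀ m₁ m₂ : ℕ, 1 ≤ m₁ → 1 ≤ m₂ →
      |∑ k₁ ∈ Icc 1 ⌊Y⌋₊, ∑ k₂ ∈ Icc 1 ⌊Y⌋₊,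
          a k₁ * a k₂ * ellp Y k₁ ^ m₁ * ellp Y k₂ ^ m₂ * (S t k₁ * S (r + s - t) k₂ * ((2 * β + ellp Y k₁ + ellp Y k₂) ^ (i - a' - r + (j - b' - s)) * R a' b' (α * k₁ * k₂)))| ≤
        Real.log Y ^ (m₁ + m₂) * ((4 * Λ) ^ (i + j) * Ψ) := by
    intro a' ha' b' hb' r s t hr hs ht
    have h := fam_Lpow (i - a' - r + (j - b' - s)) (D₁ := S t) (D₂ := S (r + s - t)) (R := R a' b') hΛ hβ hLY0 hLY hΨ
      (hfam a' b' t (r + s - t) ha' hb' (by omega) (by omega))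
    exact fam_mono hLY0 (mul_le_mul_of_nonneg_right
      (pow_le_pow_right₀ h4Λ (show i - a' - r + (j - b' - s) ≤ i + j by omega)) hΨ) h
  -- level 4: the `t`-sum
  have h4 : ∀ a' : ℕ, a' ≤ i → ∀ b' : ℕ, b' ≤ j → ∀ r s : ℕ, r ≤ i - a' → s ≤ j - b' →
      ∀ m₁ m₂ : ℕ, 1 ≤ m₁ → 1 ≤ m₂ →
      |∑ k₁ ∈ Icc 1 ⌊Y⌋₊, ∑ k₂ ∈ Icc 1 ⌊Y⌋₊,
          a k₁ * a k₂ * ellp Y k₁ ^ m₁ * ellp Y k₂ ^ m₂ * (∑ t ∈ range (r + s + 1), ((r + s).choose t : ℝ) * (S t k₁ * S (r + s - t) k₂ * ((2 * β + ellp Y k₁ + ellp Y k₂) ^ (i - a' - r + (j - b' - s)) * R a' b' (α * k₁ * k₂))))| ≤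
        Real.log Y ^ (m₁ + m₂) * ((∑ t ∈ range (r + s + 1), |((r + s).choose t : ℝ)|) * ((4 * Λ) ^ (i + j) * Ψ)) := by
    intro a' ha' b' hb' r s hr hs
    refine fam_mono hLY0 (le_of_eq (Finset.sum_mul _ _ _).symm) ?_
    exact fam_finset_sum (range (r + s + 1)) (fun t ↦ ((r + s).choose t : ℝ))
      (fun t k₁ k₂ ↦ S t k₁ * S (r + s - t) k₂ * ((2 * β + ellp Y k₁ + ellp Y k₂) ^ (i - a' - r + (j - b' - s)) * R a' b' (α * k₁ * k₂)))
      (fun _ ↦ (4 * Λ) ^ (i + j) * Ψ) fun t ht ↦ h5 a' ha' b' hb' r s t hr hs (Nat.lt_succ_iff.mp (Finset.mem_range.mp ht))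
  -- level 3: the `s`-sum
  have h3 : ∀ a' : ℕ, a' ≤ i → ∀ b' : ℕ, b' ≤ j → ∀ r : ℕ, r ≤ i - a' →
      ∀ m₁ m₂ : ℕ, 1 ≤ m₁ → 1 ≤ m₂ →
      |∑ k₁ ∈ Icc 1 ⌊Y⌋₊, ∑ k₂ ∈ Icc 1 ⌊Y⌋₊,
          a k₁ * a k₂ * ellp Y k₁ ^ m₁ * ellp Y k₂ ^ m₂ * (∑ s ∈ range (j - b' + 1), (((j - b').choose s : ℝ) * (-1) ^ s) * (∑ t ∈ range (r + s + 1), ((r + s).choose t : ℝ) * (S t k₁ * S (r + s - t) k₂ * ((2 * β + ellp Y k₁ + ellp Y k₂) ^ (i - a' - r + (j - b' - s)) * R a' b' (α * k₁ * k₂)))))| ≤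
        Real.log Y ^ (m₁ + m₂) * ((∑ s ∈ range (j - b' + 1), |((j - b').choose s : ℝ) * (-1) ^ s| * (∑ t ∈ range (r + s + 1), |((r + s).choose t : ℝ)|)) * ((4 * Λ) ^ (i + j) * Ψ)) := by
    intro a' ha' b' hb' r hr
    refine fam_mono hLY0 (le_of_eq ?_) (fam_finset_sum (range (j - b' + 1)) (fun s ↦ ((j - b').choose s : ℝ) * (-1) ^ s)
      (fun s k₁ k₂ ↦ ∑ t ∈ range (r + s + 1), ((r + s).choose t : ℝ) * (S t k₁ * S (r + s - t) k₂ * ((2 * β + ellp Y k₁ + ellp Y k₂) ^ (i - a' - r + (j - b' - s)) * R a' b' (α * k₁ * k₂))))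
      (fun s ↦ (∑ t ∈ range (r + s + 1), |((r + s).choose t : ℝ)|) * ((4 * Λ) ^ (i + j) * Ψ))
      fun s hs ↦ h4 a' ha' b' hb' r s hr (Nat.lt_succ_iff.mp (Finset.mem_range.mp hs)))
    rw [Finset.sum_mul]
    exact Finset.sum_congr rfl fun s _ ↦ by ring
  -- level 2: the `r`-sum
  have h2 : ∀ a' : ℕ, a' ≤ i → ∀ b' : ℕ, b' ≤ j →
      ∀ m₁ m₂ : ℕ, 1 ≤ m₁ → 1 ≤ m₂ →
      |∑ k₁ ∈ Icc 1 ⌊Y⌋₊, ∑ k₂ ∈ Icc 1 ⌊Y⌋₊,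
          a k₁ * a k₂ * ellp Y k₁ ^ m₁ * ellp Y k₂ ^ m₂ * (∑ r ∈ range (i - a' + 1), ((1 / 2 : ℝ) ^ (i - a' + (j - b')) * ((i - a').choose r : ℝ)) * (∑ s ∈ range (j - b' + 1), (((j - b').choose s : ℝ) * (-1) ^ s) * (∑ t ∈ range (r + s + 1), ((r + s).choose t : ℝ) * (S t k₁ * S (r + s - t) k₂ * ((2 * β + ellp Y k₁ + ellp Y k₂) ^ (i - a' - r + (j - b' - s)) * R a' b' (α * k₁ * k₂))))))| ≤
        Real.log Y ^ (m₁ + m₂) * ((∑ r ∈ range (i - a' + 1), |(1 / 2 : ℝ) ^ (i - a' + (j - b')) * ((i - a').choose r : ℝ)| * (∑ s ∈ range (j - b' + 1), |((j - b').choose s : ℝ) * (-1) ^ s| * (∑ t ∈ range (r + s + 1), |((r + s).choose t : ℝ)|))) * ((4 * Λ) ^ (i + j) * Ψ)) := by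
    intro a' ha' b' hb'
    refine fam_mono hLY0 (le_of_eq ?_) (fam_finset_sum (range (i - a' + 1))
      (fun r ↦ (1 / 2 : ℝ) ^ (i - a' + (j - b')) * ((i - a').choose r : ℝ))
      (fun r k₁ k₂ ↦ ∑ s ∈ range (j - b' + 1), (((j - b').choose s : ℝ) * (-1) ^ s) * (∑ t ∈ range (r + s + 1), ((r + s).choose t : ℝ) * (S t k₁ * S (r + s - t) k₂ * ((2 * β + ellp Y k₁ + ellp Y k₂) ^ (i - a' - r + (j - b' - s)) * R a' b' (α * k₁ * k₂)))))
      (fun r ↦ (∑ s ∈ range (j - b' + 1), |((j - b').choose s : ℝ) * (-1) ^ s| * (∑ t ∈ range (r + s + 1), |((r + s).choose t : ℝ)|)) * ((4 * Λ) ^ (i + j) * Ψ))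
      fun r hr ↦ h3 a' ha' b' hb' r (Nat.lt_succ_iff.mp (Finset.mem_range.mp hr)))
    rw [Finset.sum_mul]
    exact Finset.sum_congr rfl fun r _ ↦ by ring
  -- level 1: the `b`-sum
  have h1 : ∀ a' : ℕ, a' ≤ i →
      ∀ m₁ m₂ : ℕ, 1 ≤ m₁ → 1 ≤ m₂ →
      |∑ k₁ ∈ Icc 1 ⌊Y⌋₊, ∑ k₂ ∈ Icc 1 ⌊Y⌋₊,
          a k₁ * a k₂ * ellp Y k₁ ^ m₁ * ellp Y k₂ ^ m₂ * (∑ b ∈ range (j + 1), (j.choose b : ℝ) * (∑ r ∈ range (i - a' + 1), ((1 / 2 : ℝ) ^ (i - a' + (j - b)) * ((i - a').choose r : ℝ)) * (∑ s ∈ range (j - b + 1), (((j - b).choose s : ℝ) * (-1) ^ s) * (∑ t ∈ range (r + s + 1), ((r + s).choose t : ℝ) * (S t k₁ * S (r + s - t) k₂ * ((2 * β + ellp Y k₁ + ellp Y k₂) ^ (i - a' - r + (j - b - s)) * R a' b (α * k₁ * k₂)))))))| ≤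
        Real.log Y ^ (m₁ + m₂) * ((∑ b ∈ range (j + 1), |(j.choose b : ℝ)| * (∑ r ∈ range (i - a' + 1), |(1 / 2 : ℝ) ^ (i - a' + (j - b)) * ((i - a').choose r : ℝ)| * (∑ s ∈ range (j - b + 1), |((j - b).choose s : ℝ) * (-1) ^ s| * (∑ t ∈ range (r + s + 1), |((r + s).choose t : ℝ)|)))) * ((4 * Λ) ^ (i + j) * Ψ)) := by
    intro a' ha'
    refine fam_mono hLY0 (le_of_eq ?_) (fam_finset_sum (range (j + 1)) (fun b ↦ (j.choose b : ℝ))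
      (fun b k₁ k₂ ↦ ∑ r ∈ range (i - a' + 1), ((1 / 2 : ℝ) ^ (i - a' + (j - b)) * ((i - a').choose r : ℝ)) * (∑ s ∈ range (j - b + 1), (((j - b).choose s : ℝ) * (-1) ^ s) * (∑ t ∈ range (r + s + 1), ((r + s).choose t : ℝ) * (S t k₁ * S (r + s - t) k₂ * ((2 * β + ellp Y k₁ + ellp Y k₂) ^ (i - a' - r + (j - b - s)) * R a' b (α * k₁ * k₂))))))
      (fun b ↦ (∑ r ∈ range (i - a' + 1), |(1 / 2 : ℝ) ^ (i - a' + (j - b)) * ((i - a').choose r : ℝ)| * (∑ s ∈ range (j - b + 1), |((j - b).choose s : ℝ) * (-1) ^ s| * (∑ t ∈ range (r + s + 1), |((r + s).choose t : ℝ)|))) * ((4 * Λ) ^ (i + j) * Ψ))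
      fun b hb ↦ h2 a' ha' b (Nat.lt_succ_iff.mp (Finset.mem_range.mp hb)))
    rw [Finset.sum_mul]
    exact Finset.sum_congr rfl fun b _ ↦ by ring
  -- level 0: the `a`-sum
  have h0 : ∀ m₁ m₂ : ℕ, 1 ≤ m₁ → 1 ≤ m₂ →
      |∑ k₁ ∈ Icc 1 ⌊Y⌋₊, ∑ k₂ ∈ Icc 1 ⌊Y⌋₊,
          a k₁ * a k₂ * ellp Y k₁ ^ m₁ * ellp Y k₂ ^ m₂ * (∑ a ∈ range (i + 1), (i.choose a : ℝ) * (∑ b ∈ range (j + 1), (j.choose b : ℝ) * (∑ r ∈ range (i - a + 1), ((1 / 2 : ℝ) ^ (i - a + (j - b)) * ((i - a).choose r : ℝ)) * (∑ s ∈ range (j - b + 1), (((j - b).choose s : ℝ) * (-1) ^ s) * (∑ t ∈ range (r + s + 1), ((r + s).choose t : ℝ) * (S t k₁ * S (r + s - t) k₂ * ((2 * β + ellp Y k₁ + ellp Y k₂) ^ (i - a - r + (j - b - s)) * R a b (α * k₁ * k₂))))))))| ≤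
        Real.log Y ^ (m₁ + m₂) * ((∑ a ∈ range (i + 1), |(i.choose a : ℝ)| * (∑ b ∈ range (j + 1), |(j.choose b : ℝ)| * (∑ r ∈ range (i - a + 1), |(1 / 2 : ℝ) ^ (i - a + (j - b)) * ((i - a).choose r : ℝ)| * (∑ s ∈ range (j - b + 1), |((j - b).choose s : ℝ) * (-1) ^ s| * (∑ t ∈ range (r + s + 1), |((r + s).choose t : ℝ)|))))) * ((4 * Λ) ^ (i + j) * Ψ)) := by
    refine fam_mono hLY0 (le_of_eq ?_) (fam_finset_sum (range (i + 1)) (fun a' ↦ (i.choose a' : ℝ))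
      (fun a' k₁ k₂ ↦ ∑ b ∈ range (j + 1), (j.choose b : ℝ) * (∑ r ∈ range (i - a' + 1), ((1 / 2 : ℝ) ^ (i - a' + (j - b)) * ((i - a').choose r : ℝ)) * (∑ s ∈ range (j - b + 1), (((j - b).choose s : ℝ) * (-1) ^ s) * (∑ t ∈ range (r + s + 1), ((r + s).choose t : ℝ) * (S t k₁ * S (r + s - t) k₂ * ((2 * β + ellp Y k₁ + ellp Y k₂) ^ (i - a' - r + (j - b - s)) * R a' b (α * k₁ * k₂)))))))
      (fun a' ↦ (∑ b ∈ range (j + 1), |(j.choose b : ℝ)| * (∑ r ∈ range (i - a' + 1), |(1 / 2 : ℝ) ^ (i - a' + (j - b)) * ((i - a').choose r : ℝ)| * (∑ s ∈ range (j - b + 1), |((j - b).choose s : ℝ) * (-1) ^ s| * (∑ t ∈ range (r + s + 1), |((r + s).choose t : ℝ)|)))) * ((4 * Λ) ^ (i + j) * Ψ))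
      fun a' ha' ↦ h1 a' (Nat.lt_succ_iff.mp (Finset.mem_range.mp ha')))
    rw [Finset.sum_mul]
    exact Finset.sum_congr rfl fun a' _ ↦ by ring
  -- the weight, distributed
  have hW : ∀ k₁ k₂ : ℕ, (∑ a ∈ range (i + 1), ∑ b ∈ range (j + 1),
                (i.choose a : ℝ) * (j.choose b) *
                ((1 / 2) ^ (i - a + (j - b)) * ∑ r ∈ range (i - a + 1), ∑ s ∈ range (j - b + 1),
                  ((i - a).choose r : ℝ) * ((j - b).choose s) * (-1) ^ s *
                      (2 * β + ellp Y k₁ + ellp Y k₂) ^ (i - a - r + (j - b - s)) *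
                    ∑ t ∈ range (r + s + 1), ((r + s).choose t : ℝ) *
                      (S t k₁ *
                        S (r + s - t) k₂)) *
                R a b (α * k₁ * k₂)) =
      ∑ a ∈ range (i + 1), (i.choose a : ℝ) * (∑ b ∈ range (j + 1), (j.choose b : ℝ) * (∑ r ∈ range (i - a + 1), ((1 / 2 : ℝ) ^ (i - a + (j - b)) * ((i - a).choose r : ℝ)) * (∑ s ∈ range (j - b + 1), (((j - b).choose s : ℝ) * (-1) ^ s) * (∑ t ∈ range (r + s + 1), ((r + s).choose t : ℝ) * (S t k₁ * S (r + s - t) k₂ * ((2 * β + ellp Y k₁ + ellp Y k₂) ^ (i - a - r + (j - b - s)) * R a b (α * k₁ * k₂))))))) := by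
    intro k₁ k₂
    simp only [Finset.mul_sum, Finset.sum_mul]
    refine Finset.sum_congr rfl fun a' _ ↦ Finset.sum_congr rfl fun b' _ ↦ Finset.sum_congr rfl fun r _ ↦
      Finset.sum_congr rfl fun s _ ↦ Finset.sum_congr rfl fun t _ ↦ ?_
    ring
  intro m₁ m₂ hm₁ hm₂
  rw [Finset.sum_congr rfl fun k₁ _ ↦ Finset.sum_congr rfl fun k₂ _ ↦ by rw [hW k₁ k₂]]
  refine (h0 m₁ m₂ hm₁ hm₂).trans (le_of_eq ?_)
  ring

end Summit.Parity.GeneralizedHardyLittlewood.Theorems.MomentsBeyondDiagonal.DiagCorner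

end
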